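import Literature.Topology.FourManifolds.NullhomotopicNormalFraming
import Literature.Topology.FourManifolds.OrientationSign

/-!
# The orientation character of a tangent–normal frame along a surface is constant
(registered helper `helper_posFrameAlongSurfaceConst` of the stub `stub_normalWitnessTransfer`,
line `cross-cap-laurent`, crux `GromovRecognitionRelEnd`, item stmt-SmoothPoincare4-11009)

Setting (`Literature.Topology.FourManifolds.CodimTwoData 2 X S ℝᵐ`): a Whitney embedding
`e : X → ℝᵐ` of the `4`-manifold `X` (smooth, with injective differential) and an embedded
surface `b : S → X`; a smooth map `c : O → S` on an open preconnected `O ⊆ ℂ`; two fields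
`N₁ z, N₂ z ∈ T_{b (c z)} X` whose images `de (N_j z) = ν_j z` are smooth `ℝᵐ`-valued fields on
`O`; and the moving `4`-frame `(d(b ∘ c)_z 1, d(b ∘ c)_z i, N₁ z, N₂ z)` of `T_{b (c z)} X`,
assumed linearly independent on `O`.  Claim (`helper_posFrameAlongSurfaceConst`): its orientation
character (`SmoothOrientation.IsPosFrame` for a smooth orientation `o` of `X`, the frame being
reindexed by `finCongr finrank_euclideanSpace_fin`) is the same at all points of `O`
(M. W. Hirsch, *Differential Topology* (1976), Ch. 4 §4: the orientation of a continuously moving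
frame is constant along a connected parameter set).

Proof: the tree's constancy principle
`Literature.Topology.FourManifolds.SmoothOrientation.isPosFrame_iff_of_isPreconnected`, whose
hypotheses are checked as follows.  Non-degeneracy: `det_ne_zero_of_linearIndependent` (linear
independence is invariant under reindexing).  Continuity of the frame read in the chart at
`p : X`, on `O ∩ (b ∘ c)⁻¹(chart domain of p)`:
* tangent vectors (`HelperPosFrameAlongSurfaceConst.continuousOn_tangentCoordChange_mfderiv`):
  the reading `Dφ_p ∘ d(b ∘ c)_z` is the honest derivative of the map `φ_p ∘ b ∘ c` between
  vector spaces (`mfderiv_chartAt_eq_tangentCoordChange`, `mfderiv_comp`, `mfderiv_eq_fderiv`),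
  continuous on the open set where this composite is `C^∞`
  (`ContDiffOn.continuousOn_fderiv_of_isOpen`);
* normal vectors (`HelperPosFrameAlongSurfaceConst.continuousOn_tangentCoordChange_normal`):
  `N_j z = leftInv (de) (ν_j z)` (`leftInv_apply_self`, `de` injective), whose reading is
  `leftInv (D(e ∘ φ_p⁻¹)(φ_p (b (c z)))) (ν_j z)`
  (`CodimTwoData.tangentCoordChange_leftInv_mfderiv_e`), continuous because the chart derivative
  is smooth (`contDiffOn_chartDeriv`) and injective (`injective_chartDeriv`), and `leftInv` is
  smooth at injective maps (`contDiffAt_leftInv`) — the argument of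
  `CodimTwoData.isSmoothAlong_framingOf`.

Reference: M. W. Hirsch, *Differential Topology*, GTM 33, Springer (1976), Ch. 4 §4
[HirschDT1976].  No new definitions.
-/

noncomputable section

open Set Function Module
open scoped Manifold ContDiff Topology

-- the prescribed namespace `Summit.<P>.<Sub>.…` duplicates `SmoothPoincare4` (P = Sub)
set_option linter.dupNamespace false

namespace Summit.SmoothPoincare4.SmoothPoincare4.Theorems.GromovRecognitionRelEnd.CrossCapLaurent

open Literature.Topology.FourManifolds

namespace HelperPosFrameAlongSurfaceConst

/-- **Readings of velocity vectors are continuous.**  For a map `γ : P → M` from a normed space,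
`C^∞` on an open set `O`, and a fixed vector `v`, the reading
`z ↦ Dφ_p (dγ_z v)` of the velocity `dγ_z v` in the chart `φ_p` at `p` is continuous on
`O ∩ γ⁻¹(chart domain of p)`: it is the derivative of the map `φ_p ∘ γ` between vector spaces,
which is `C^∞` on that open set. [folklore] -/
theorem continuousOn_tangentCoordChange_mfderiv {E : Type*} [NormedAddCommGroup E]
    [NormedSpace ℝ E] {M : Type*} [TopologicalSpace M] [ChartedSpace E M]
    [IsManifold 𝓘(ℝ, E) ∞ M] {P : Type*} [NormedAddCommGroup P] [NormedSpace ℝ P]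
    {γ : P → M} {O : Set P} (hO : IsOpen O) (hγ : ContMDiffOn 𝓘(ℝ, P) 𝓘(ℝ, E) ∞ γ O)
    (p : M) (v : P) :
    ContinuousOn
      (fun z => tangentCoordChange 𝓘(ℝ, E) (γ z) p (γ z) (mfderiv 𝓘(ℝ, P) 𝓘(ℝ, E) γ z v))
      (O ∩ γ ⁻¹' (chartAt E p).source) := by
  have hU : IsOpen (O ∩ γ ⁻¹' (chartAt E p).source) :=
    hγ.continuousOn.isOpen_inter_preimage hO (chartAt E p).open_source
  have h1 : ContMDiffOn 𝓘(ℝ, P) 𝓘(ℝ, E) ∞ (chartAt E p ∘ γ) (O ∩ γ ⁻¹' (chartAt E p).source) :=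
    (contMDiffOn_chart (x := p)).comp (hγ.mono inter_subset_left) fun z hz => hz.2
  have h2 : ContinuousOn (fun z => fderiv ℝ (chartAt E p ∘ γ) z v)
      (O ∩ γ ⁻¹' (chartAt E p).source) :=
    (h1.contDiffOn.continuousOn_fderiv_of_isOpen hU (by simp)).clm_apply continuousOn_const
  have key : ∀ z ∈ O ∩ γ ⁻¹' (chartAt E p).source,
      tangentCoordChange 𝓘(ℝ, E) (γ z) p (γ z) (mfderiv 𝓘(ℝ, P) 𝓘(ℝ, E) γ z v) =
        fderiv ℝ (chartAt E p ∘ γ) z v := by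
    intro z hz
    have hz2 : γ z ∈ (chartAt E p).source := hz.2
    have hγz : MDifferentiableAt 𝓘(ℝ, P) 𝓘(ℝ, E) γ z :=
      (hγ.mdifferentiableOn (by simp) z hz.1).mdifferentiableAt (hO.mem_nhds hz.1)
    have hc : MDifferentiableAt 𝓘(ℝ, E) 𝓘(ℝ, E) (chartAt E p) (γ z) :=
      mdifferentiableAt_atlas (chart_mem_atlas E p) hz2
    rw [← mfderiv_chartAt_eq_tangentCoordChange (I := 𝓘(ℝ, E)) hz2, ← mfderiv_eq_fderiv,
      mfderiv_comp z hc hγz]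
    rfl
  exact h2.congr key

variable {k : ℕ} {X : Type*} [TopologicalSpace X] [ChartedSpace (EuclideanSpace ℝ (Fin (k + 2))) X]
  [IsManifold (𝓡 (k + 2)) ∞ X]
  {S : Type*} [TopologicalSpace S] [ChartedSpace (EuclideanSpace ℝ (Fin k)) S]
  [IsManifold (𝓡 k) ∞ S]
  {V : Type*} [NormedAddCommGroup V] [InnerProductSpace ℝ V] [FiniteDimensional ℝ V]

/-- **Readings of pulled-back tangent vectors are continuous.**  In the Whitney picture
`D : CodimTwoData k X S V` (embedding `e : X → V` with injective differential), let `γ : Y → X`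
and `ν : Y → V` be continuous on `T`, and let `N y ∈ T_{γ y} X` satisfy `de (N y) = ν y` on `T`.
Then the reading `y ↦ Dφ_p (N y)` of `N y` in the chart at `p` is continuous on
`T ∩ γ⁻¹(chart domain of p)`: `N y = leftInv (de_{γ y}) (ν y)`, whose reading is
`leftInv (D(e ∘ φ_p⁻¹)(φ_p (γ y))) (ν y)` (`CodimTwoData.tangentCoordChange_leftInv_mfderiv_e`),
and `leftInv` is smooth at the injective chart derivatives (the argument of
`CodimTwoData.isSmoothAlong_framingOf`). [folklore] -/
theorem continuousOn_tangentCoordChange_normal (D : CodimTwoData k X S V) {Y : Type*}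
    [TopologicalSpace Y] {T : Set Y} {γ : Y → X} {ν : Y → V}
    {N : Y → EuclideanSpace ℝ (Fin (k + 2))} (hγ : ContinuousOn γ T) (hν : ContinuousOn ν T)
    (hN : ∀ y ∈ T, mfderiv (𝓡 (k + 2)) 𝓘(ℝ, V) D.e (γ y) (N y) = ν y) (p : X) :
    ContinuousOn (fun y => tangentCoordChange (𝓡 (k + 2)) (γ y) p (γ y) (N y))
      (T ∩ γ ⁻¹' (chartAt (EuclideanSpace ℝ (Fin (k + 2))) p).source) := by
  have heq : ∀ y ∈ T ∩ γ ⁻¹' (chartAt (EuclideanSpace ℝ (Fin (k + 2))) p).source,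
      tangentCoordChange (𝓡 (k + 2)) (γ y) p (γ y) (N y) =
        leftInv (chartDeriv (𝓡 (k + 2)) D.e p (extChartAt (𝓡 (k + 2)) p (γ y))) (ν y) := by
    intro y hy
    have hy2 : γ y ∈ (chartAt (EuclideanSpace ℝ (Fin (k + 2))) p).source := hy.2
    have h1 : N y = leftInv (D.eDeriv (γ y)) (ν y) := by
      rw [← hN y hy.1]
      exact (leftInv_apply_self (D.eDeriv_injective (γ y)) (N y)).symm
    have h2 : ν y ∈ tangentPlane (𝓡 (k + 2)) D.e (γ y) := by
      rw [← hN y hy.1]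
      exact mfderiv_mem_tangentPlane _ _ _
    rw [h1]
    exact D.tangentCoordChange_leftInv_mfderiv_e hy2 h2
  refine ContinuousOn.congr ?_ heq
  have hφ : ContinuousOn (fun y => extChartAt (𝓡 (k + 2)) p (γ y))
      (T ∩ γ ⁻¹' (chartAt (EuclideanSpace ℝ (Fin (k + 2))) p).source) := by
    refine (continuousOn_extChartAt p).comp (hγ.mono inter_subset_left) fun y hy => ?_
    rw [extChartAt_source]
    exact hy.2
  have hA : ContinuousOn (fun y => chartDeriv (𝓡 (k + 2)) D.e p (extChartAt (𝓡 (k + 2)) p (γ y)))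
      (T ∩ γ ⁻¹' (chartAt (EuclideanSpace ℝ (Fin (k + 2))) p).source) := by
    refine (contDiffOn_chartDeriv D.he p).continuousOn.comp hφ fun y hy => ?_
    exact (extChartAt (𝓡 (k + 2)) p).map_source (by rw [extChartAt_source]; exact hy.2)
  have hL : ContinuousOn
      (fun y => leftInv (chartDeriv (𝓡 (k + 2)) D.e p (extChartAt (𝓡 (k + 2)) p (γ y))))
      (T ∩ γ ⁻¹' (chartAt (EuclideanSpace ℝ (Fin (k + 2))) p).source) := by
    intro y hy
    have hx' : γ y ∈ (extChartAt (𝓡 (k + 2)) p).source := by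
      rw [extChartAt_source]
      exact hy.2
    have hC : Injective (chartDeriv (𝓡 (k + 2)) D.e p (extChartAt (𝓡 (k + 2)) p (γ y))) :=
      injective_chartDeriv hx' (D.mdifferentiableAt_e _) (D.hde _)
    exact (contDiffAt_leftInv hC).continuousAt.comp_continuousWithinAt
      (f := fun y => chartDeriv (𝓡 (k + 2)) D.e p (extChartAt (𝓡 (k + 2)) p (γ y))) (x := y)
      (hA y hy)
  exact hL.clm_apply (hν.mono inter_subset_left)

end HelperPosFrameAlongSurfaceConst

open HelperPosFrameAlongSurfaceConst in
/-- **Registered helper `helper_posFrameAlongSurfaceConst`: the orientation character of a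
tangent–normal frame along a surface is constant.**  In the Whitney picture
`D : CodimTwoData 2 X S ℝᵐ` of an embedded surface `b : S → X` in a `4`-manifold `X` with smooth
orientation `o`, along a smooth map `c : O → S` (`O ⊆ ℂ` open and preconnected), the `4`-frame
`(d(b ∘ c)_z 1, d(b ∘ c)_z i, N₁ z, N₂ z)` of `T_{b (c z)} X` — where `de (N_j z) = ν_j z` are
smooth on `O` — is, if linearly independent on `O`, positively oriented either at every point
of `O` or at none (Hirsch, *Differential Topology* (1976), Ch. 4 §4: apply
`SmoothOrientation.isPosFrame_iff_of_isPreconnected`; the chart readings of the frame are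
continuous by `continuousOn_tangentCoordChange_mfderiv` and
`continuousOn_tangentCoordChange_normal`). [folklore] -/
theorem helper_posFrameAlongSurfaceConst : ∀ (m : ℕ) (X : Type) [TopologicalSpace X] [ChartedSpace (EuclideanSpace ℝ (Fin 4)) X] [IsManifold (𝓡 4) ∞ X] (S : Type) [TopologicalSpace S] [ChartedSpace (EuclideanSpace ℝ (Fin 2)) S] [IsManifold (𝓡 2) ∞ S] (D : Literature.Topology.FourManifolds.CodimTwoData 2 X S (EuclideanSpace ℝ (Fin m))) (o : Literature.Topology.FourManifolds.SmoothOrientation (𝓡 4) X) (c : ℂ → S) (ν₁ ν₂ : ℂ → EuclideanSpace ℝ (Fin m)) (N₁ N₂ : ℂ → EuclideanSpace ℝ (Fin 4)) (O : Set ℂ), IsOpen O → IsPreconnected O → ContMDiffOn 𝓘(ℝ, ℂ) (𝓡 2) ∞ c O → ContMDiffOn 𝓘(ℝ, ℂ) 𝓘(ℝ, EuclideanSpace ℝ (Fin m)) ∞ ν₁ O → ContMDiffOn 𝓘(ℝ, ℂ) 𝓘(ℝ, EuclideanSpace ℝ (Fin m)) ∞ ν₂ O → (∀ z ∈ O, mfderiv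 (𝓡 4) 𝓘(ℝ, EuclideanSpace ℝ (Fin m)) D.e (D.b (c z)) (N₁ z) = ν₁ z ∧ mfderiv (𝓡 4) 𝓘(ℝ, EuclideanSpace ℝ (Fin m)) D.e (D.b (c z)) (N₂ z) = ν₂ z) → (∀ z ∈ O, LinearIndependent ℝ ![mfderiv 𝓘(ℝ, ℂ) (𝓡 4) (fun z => D.b (c z)) z (1 : ℂ), mfderiv 𝓘(ℝ, ℂ) (𝓡 4) (fun z => D.b (c z)) z Complex.I, N₁ z, N₂ z]) → ∀ z ∈ O, ∀ z' ∈ O, (o.IsPosFrame (D.b (c z)) (![mfderiv 𝓘(ℝ, ℂ) (𝓡 4) (fun z => D.b (c z)) z (1 : ℂ), mfderiv 𝓘(ℝ, ℂ) (𝓡 4) (fun z => D.b (c z)) z Complex.I, N₁ z, N₂ z] ∘ ⇑(finCongr finrank_euclideanSpace_fin)) ↔ o.IsPosFrame (D.b (c z')) (![mfderiv 𝓘(ℝ, ℂ) (𝓡 4) (fun z => D.b (c z)) z' (1 : ℂ), mfderiv 𝓘(ℝ, ℂ) (𝓡 4) (fun z => D.b (c z)) z' Complex.I, N₁ z', N₂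 z'] ∘ ⇑(finCongr finrank_euclideanSpace_fin))) := by
  intro m X _ _ _ S _ _ _ D o c ν₁ ν₂ N₁ N₂ O hO hOc hc hν₁ hν₂ hN hli z hz z' hz'
  -- the surface map `γ = b ∘ c : O → X` is smooth
  have hγ : ContMDiffOn 𝓘(ℝ, ℂ) (𝓡 4) ∞ (fun w => D.b (c w)) O := D.hb.comp_contMDiffOn hc
  refine o.isPosFrame_iff_of_isPreconnected hOc (γ := fun w => D.b (c w))
    (B := fun w => ![mfderiv 𝓘(ℝ, ℂ) (𝓡 4) (fun z => D.b (c z)) w (1 : ℂ),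
      mfderiv 𝓘(ℝ, ℂ) (𝓡 4) (fun z => D.b (c z)) w Complex.I, N₁ w, N₂ w] ∘
        ⇑(finCongr finrank_euclideanSpace_fin))
    hγ.continuousOn (fun p => ?_) (fun w hw => ?_) hz hz'
  · -- the readings of the frame in the chart at `p` are continuous
    refine continuousOn_pi.2 fun i => ?_
    have key : ∀ j : Fin 4, ContinuousOn
        (fun w => tangentCoordChange (𝓡 4) (D.b (c w)) p (D.b (c w))
          (![mfderiv 𝓘(ℝ, ℂ) (𝓡 4) (fun z => D.b (c z)) w (1 : ℂ),
            mfderiv 𝓘(ℝ, ℂ) (𝓡 4) (fun z => D.b (c z)) w Complex.I, N₁ w, N₂ w] j))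
        (O ∩ (fun w => D.b (c w)) ⁻¹' (chartAt (EuclideanSpace ℝ (Fin 4)) p).source) := by
      intro j
      fin_cases j
      · exact continuousOn_tangentCoordChange_mfderiv hO hγ p (1 : ℂ)
      · exact continuousOn_tangentCoordChange_mfderiv hO hγ p Complex.I
      · exact continuousOn_tangentCoordChange_normal D hγ.continuousOn hν₁.continuousOn
          (fun w hw => (hN w hw).1) p
      · exact continuousOn_tangentCoordChange_normal D hγ.continuousOn hν₂.continuousOn
          (fun w hw => (hN w hw).2) p
    exact key _
  · -- the frame is non-degenerate
    exact det_ne_zero_of_linearIndependent _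
      ((hli w hw).comp _ (finCongr finrank_euclideanSpace_fin).injective)

end Summit.SmoothPoincare4.SmoothPoincare4.Theorems.GromovRecognitionRelEnd.CrossCapLaurent
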